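import Mathlib
import HarnessLib
import Summits.RiemannHypothesis.RiemannHypothesis.Theses.WeilWindowFlow
import Literature.NumberTheory.LFunctions.WeilExplicit
import Literature.NumberTheory.LFunctions.WeilDilationVirial
import Literature.NumberTheory.LFunctions.WeilGroundState
import Literature.NumberTheory.LFunctions.WeilExplicitFormulaProofs
import Literature.NumberTheory.LFunctions.WeilWindowSuzukiContinuityProofs

/-!
# Sketch — crux-ideate `stmt-RiemannHypothesis-1038` (DiniLeakage), ideator 2, round 1

First lemmas of three crux idea cards (`Ideas/*.md`); every constant is an existing declaration.
Nothing here is proved; the `def … : Prop`s must elaborate.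
-/

noncomputable section

open Set Filter MeasureTheory
open scoped Real Topology

namespace Summit.RiemannHypothesis.RiemannHypothesis.Cruxes.DiniLeakage.Sketch

open Literature.NumberTheory.LFunctions
open Summit.RiemannHypothesis.RiemannHypothesis.Theses.WeilWindowFlow

/-! ## Card `spectral-virial-shadow` -/

/-- First lemma (B1, provable now from `explicit_formula_holds`): Bombieri's dilation virial of a
test function IS a linear statistic of the zeros — the real part of the zero side of the explicit
formula applied to the Euler generator `D(g ⋆ g̃)`, `(Dk)^(ρ) = -k̂(ρ) - (ρ - 1/2)(t k)^(ρ)`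
(`weilMellin_weilDilationGenerator`). -/
def VirialIsZeroStatistic : Prop :=
  ∀ g : ℝ → ℂ, IsWeilTest g →
    ∃ Z : ℂ, HasWeilZeroSide (weilDilationGenerator (weilConv g (weilReflect g))) Z ∧
      Z.re = weilDilationVirial g

/-- First lemma (B2, pure algebra, provable now): polarization of the Euler generator of an
autocorrelation, `t·(g ⋆ g̃)'(t) = ((t g)' ⋆ g̃)(t) + (g ⋆ ((t g)')~)(t) − (g ⋆ g̃)(t)`,
so that `V(g) = 2 Re Q((t g)', g) − Re Q(g)` for the sesquilinear Weil form `Q(u,v) = W(u ⋆ ṽ)`. -/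
def GeneratorPolarization : Prop :=
  ∀ g : ℝ → ℂ, IsWeilTest g →
    weilDilationGenerator (weilConv g (weilReflect g)) =
      fun t ↦ weilConv (deriv fun s : ℝ ↦ (s : ℂ) * g s) (weilReflect g) t
        + weilConv g (weilReflect (deriv fun s : ℝ ↦ (s : ℂ) * g s)) t
        - weilConv g (weilReflect g) t

/-- The card's transfer target C⁺ (`VirialLeakage`, RH-strength, = the route's informal mechanism
(i)+(ii) made a statement): on compact window ranges the dilation virial of every NEAR-minimiser
is slaved to the ground energy.  With B1 this reads `W((aK − t∂ₜ)(ψ ⋆ ψ̃)) ≥ −aη`, a sign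
condition on ONE explicit non-positive-definite test function per window. -/
def VirialLeakage : Prop :=
  ∀ b₀ A : ℝ, 0 < b₀ → b₀ ≤ A → ∃ K : ℝ, ∀ a : ℝ, b₀ ≤ a → a ≤ A → ∀ η : ℝ, 0 < η →
    ∃ θ : ℝ, 0 < θ ∧ ∀ ψ : ℝ → ℂ, IsWeilTest ψ → tsupport ψ ⊆ Icc (-a) a →
      ∫ t : ℝ, ‖ψ t‖ ^ 2 = 1 → (weilQuadratic ψ).re ≤ weilGroundEnergy a + θ →
        weilDilationVirial ψ ≤ a * (K * weilGroundEnergy a + η)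

/-- Glue claim of the card (provable real analysis + `weilQuadratic_weilDilate` +
`hasDerivAt_re_weilQuadratic_weilDilate` once landed): slaved virial ⇒ the crux. -/
def VirialLeakage_implies_crux : Prop :=
  VirialLeakage → DiniLeakage

/-! ## Card `coercive-mod-prolate-block` -/

/-- First lemma (A1, provable now from the compactness of the window form, cf.
`Literature/NumberTheory/LFunctions/WeilSemilocalCompactness.lean`): on every compact window range
Weil's form is UNIFORMLY COERCIVE on a subspace of UNIFORMLY BOUNDED CODIMENSION — the whole
`no-margin' phenomenon lives in a finite block.  The card's bet identifies the block with the
window-truncated radical images of the first ≈ 2e^{2A} prolate spheroidal functions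
(Connes–Consani's prolate projection Π(λ,k)) and takes `c` of order one. -/
def CoerciveModFiniteBlock : Prop :=
  ∀ b₀ A : ℝ, 0 < b₀ → b₀ ≤ A → ∀ c : ℝ, ∃ N : ℕ, ∀ a : ℝ, b₀ ≤ a → a ≤ A →
    ∃ F : Fin N → (ℝ → ℂ), ∀ g : ℝ → ℂ, IsWeilTest g → tsupport g ⊆ Icc (-a) a →
      (∀ i, ∫ t : ℝ, starRingEnd ℂ (F i t) * g t = 0) →
        c * ∫ t : ℝ, ‖g t‖ ^ 2 ≤ (weilQuadratic g).re

/-- A2 (Connes's near-radical envelope, an UPPER bound; rigorous version of arXiv:2602.04022 §6.4 /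
Fuchs 1964): the window bottom is super-exponentially small. -/
def SuperExpUpperEnvelope : Prop :=
  ∃ C p a₁ : ℝ, 0 < C ∧ ∀ a : ℝ, a₁ ≤ a →
    weilGroundEnergy a ≤ C * Real.exp (p * a) * Real.exp (-(4 * π * Real.exp (2 * a)))

/-- A3 (sharpness of the crux, provable from A2 + the proved coercive anchor): any Grönwall rate
for the window bottom must integrate to at least `4π e^{2A} − O(A)`; in particular no
`K(b₀,A) = o(e^{2A})` can witness `DiniLeakage`/`GronwallLeakage`. -/
def EnvelopeForcesRate : Prop :=
  SuperExpUpperEnvelope →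
    ∀ C : ℝ → ℝ, (∀ b a : ℝ, 0 < b → b ≤ a → IntervalIntegrable C volume b a ∧
        weilGroundEnergy b * Real.exp (-(∫ x in b..a, C x)) ≤ weilGroundEnergy a) →
      ∀ b : ℝ, 0 < b → 0 < weilGroundEnergy b → ∃ M : ℝ, ∀ a : ℝ, b ≤ a →
        4 * π * Real.exp (2 * a) - M * (1 + |a|) ≤ ∫ x in b..a, C x

/-! ## Card `archimedean-leakage-rung` -/

/-- First lemma / child 1 of the proposed glued split (C1, prime-free and RH-free target): the crux
restricted to windows below the first prime, where `Q = polar + archimedean` is an explicit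
special-function form, positivity is a theorem (`weilPositivityOn_of_le_log_two_half`) and the
minimiser is essentially one prolate function. -/
def ArchimedeanDiniLeakage : Prop :=
  ∀ b₀ A : ℝ, 0 < b₀ → b₀ ≤ A → A ≤ Real.log 2 / 2 → ∃ K : ℝ, 0 ≤ K ∧ ∀ a : ℝ, b₀ ≤ a → a ≤ A →
    ∀ η δ : ℝ, 0 < η → 0 < δ → ∃ h : ℝ, 0 < h ∧ h < δ ∧
      weilGroundEnergy a - weilGroundEnergy (a + h) ≤ h * (K * weilGroundEnergy a + η)

/-- Child 2 (the RH-strength remainder): the crux on ranges starting at the dyadic window. -/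
def PrimeDiniLeakage : Prop :=
  ∀ b₀ A : ℝ, Real.log 2 / 2 ≤ b₀ → b₀ ≤ A → ∃ K : ℝ, 0 ≤ K ∧ ∀ a : ℝ, b₀ ≤ a → a ≤ A →
    ∀ η δ : ℝ, 0 < η → 0 < δ → ∃ h : ℝ, 0 < h ∧ h < δ ∧
      weilGroundEnergy a - weilGroundEnergy (a + h) ≤ h * (K * weilGroundEnergy a + η)

/-- Glue of the split (elementary: `K := max K₁ K₂`, using `K ≥ 0` and `ε ≥ 0`, the latter from
the proved dyadic positivity below `log 2 / 2` and, above it, forced by child 2 itself via the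
antitonicity of `ε`). -/
def SplitGlue : Prop :=
  ArchimedeanDiniLeakage → PrimeDiniLeakage → DiniLeakage

/-- C2 (strict archimedean bottom on the whole prime-free range; extends the route's support item
`StrictArchimedeanBottom` from the single point `log 2 / 2`). -/
def StrictArchimedeanRange : Prop :=
  ∀ a : ℝ, 0 < a → a ≤ Real.log 2 / 2 → 0 < weilGroundEnergy a

/-! ## Two of the above, proved (cheap checks that the first lemmas are the right shape) -/

/-- B1 holds: it is the explicit formula applied to the test function `D(g ⋆ g̃)`. -/
theorem virialIsZeroStatistic_holds : VirialIsZeroStatistic := by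
  intro g hg
  refine ⟨_, explicit_formula_holds (hg.weilConv hg.weilReflect).weilDilationGenerator, ?_⟩
  rfl

/-- Antitonicity of the window bottom (used by `SplitGlue`): a larger window has a smaller bottom. -/
theorem weilGroundEnergy_antitone {a b : ℝ} (hb : 0 < b) (hba : b ≤ a) :
    weilGroundEnergy a ≤ weilGroundEnergy b := by
  refine le_weilGroundEnergy_of_forall hb fun h hh hsupp hnorm ↦ ?_
  exact weilGroundEnergy_le_re_weilQuadratic hh
    (hsupp.trans (Icc_subset_Icc (neg_le_neg hba) hba)) hnorm

end Summit.RiemannHypothesis.RiemannHypothesis.Cruxes.DiniLeakage.Sketch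

end
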